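import Summits.BirchSwinnertonDyer.BirchSwinnertonDyer.Theorems.KolyvaginRankRigidityAtTwoWalkStepSign
import Summits.BirchSwinnertonDyer.BirchSwinnertonDyer.Theorems.KolyvaginRankRigidityAtTwoWalkStepTransfer
import Summits.BirchSwinnertonDyer.BirchSwinnertonDyer.Theorems.KolyvaginRankRigidityAtTwoOffHabitatIrredInflationDefectSah
import Summits.BirchSwinnertonDyer.BirchSwinnertonDyer.Theorems.ClassRecordThreeEulerHalvesAtThreeWalkSupplyTransverse
import Summits.BirchSwinnertonDyer.BirchSwinnertonDyer.Theorems.ClassRecordThreeEulerHalvesAtThreeWalkFinite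
import Summits.BirchSwinnertonDyer.BirchSwinnertonDyer.Theorems.Rank1ResidualJetSelmerLemmas
import HarnessLib

/-!
# Crux U1 `KolyvaginBoundedDefectAtTwo` (stmt-BirchSwinnertonDyer-28083), LINE 17 `regular_core_rigidity`,
# stub S1b `stub_nearCoreExistenceAtTwo` — THE WALK, part 0: BRIDGES between the vertices
# `H_{𝓕(c)} = Jetchev2008.modifiedSelmerGroup W K ι 2^k c` (the currency of S1b) and the structure-level
# vertices `H¹_{selmerF W 2^k 𝒯 (placesDividing K c)}` of the step-local layer (g13/g14)

Width seat `bsd-line-krr2-p2` g15 (ONE READER on S1b); `--supports stmt-BirchSwinnertonDyer-28083` (helper).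
THEOREMS ONLY; nothing here proves S1b, U1, a rung or BSD. BSD is NOT proved.

The step-local theorems (`…WalkStepGoodLocal`, `…WalkStepPureLocal`, `…WalkStepSign`, …) are stated for a transverse
family `𝒯` described place by place RELATIVE TO A CONDUCTOR `c'` (`𝒯_v = ⨅_{ℓ ∣ c', ℓ ∈ v} ⨅_{w' ∣ v} H¹_tr`, `= ⊤` off
`c'`). The walk's vertices are the parameter-free modules `modifiedSelmerGroup W K ι n c`. This file proves, once:
* `placesDividing_subset_of_dvd` — `c ∣ c' ≠ 0 ⇒ placesDividing K c ⊆ placesDividing K c'`;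
* `selmerGroup_selmerF_eq_modifiedSelmerGroup_of_dvd` — for square-free `c'`, `c ∣ c'` and ANY family `𝒯` with the
  `c'`-description: `H¹_{selmerF W n 𝒯 (placesDividing K c)} = modifiedSelmerGroup W K ι n c` (through JET's global
  transverse family and `globalTransverse_mem_iff`);
* `selmerGroup_update_kummer_eq_modifiedSelmerGroup` — the previous vertex of a step: for `c' = c ℓ`,
  `H¹_{𝓕(cℓ)[v ↦ Kum_v]} = modifiedSelmerGroup W K ι n c`;
* `conjAct_mem_modifiedSelmerGroup` — `τ_*`-stability of every vertex;
* `finite_modifiedSelmerGroup` — finiteness of every vertex (`n ≠ 0`);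
* `exists_place_natCast_mem_of_kolyvaginPrime` — the place `λ = (ℓ)` of an inert Kolyvagin prime;
* `two_zsmul_eq_zero_of_res_eq_zero` — Sah at `2` on the habitat: a class of `H¹(K, E[2^k])` vanishing on
  `Γ_{K(E[2^(k+1)])}` is killed by `2`;
* `localization_eq_zero_of_res_eq_zero` — and is locally trivial at every Kolyvagin place of index `≥ k+1` (Φ-kill).
References (locators only; no cited FACT is declared): [cite: Jetchev2008, §3.1.2, §3.4.1] [cite: MazurRubin2004, §4.1]
[cite: GrossLMS1991, §9 Prop. 9.1].
Design: no definitions; `K : Type`; axioms `propext`, `Classical.choice`, `Quot.sound`.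
-/

set_option autoImplicit false
-- the Theorems namespace of this sub repeats the summit name by design (D-0017 nested layout)
set_option linter.dupNamespace false

noncomputable section

open scoped Classical
open Function NumberField IsDedekindDomain WeierstrassCurve Field
open Literature.NumberTheory.EllipticCurves Literature.NumberTheory.EllipticCurves.Jetchev2008
open Literature.NumberTheory.EllipticCurves.KolyvaginPairing
open Literature.NumberTheory.GaloisRepresentations Literature.NumberTheory.GaloisCohomology
open Literature.NumberTheory.GaloisRepresentations.DiscreteGaloisModule (transverseSubgroup SelmerStructure)
open Literature.NumberTheory.Automorphic
open Summit.BirchSwinnertonDyer.Rank1Residual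
open Summit.BirchSwinnertonDyer.Rank1Residual.JET.SelmerVocabulary

namespace Summit.BirchSwinnertonDyer.BirchSwinnertonDyer.Theorems.KolyvaginAtTwo.RegularWalk

variable {K : Type} [Field K] [NumberField K] (W : WeierstrassCurve ℚ)

/-! ### §1 Places dividing a conductor -/

/-- `c ∣ c' ≠ 0 ⇒ {λ ∣ c} ⊆ {λ ∣ c'}`. [folklore] -/
theorem placesDividing_subset_of_dvd {c c' : ℕ} (hc' : c' ≠ 0) (h : c ∣ c') :
    placesDividing K c ⊆ placesDividing K c' := by
  intro v hv
  have hc : c ≠ 0 := by rintro rfl; exact hc' (zero_dvd_iff.mp h)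
  rw [mem_placesDividing_iff_natCast_mem hc] at hv
  rw [mem_placesDividing_iff_natCast_mem hc']
  obtain ⟨d, rfl⟩ := h
  rw [Nat.cast_mul]
  exact v.asIdeal.mul_mem_right _ hv

/-- The place `λ = (ℓ)` of `K` above an inert Kolyvagin prime `ℓ`. [cite: GrossLMS1991, §3 (after (3.2))] -/
theorem exists_place_natCast_mem_of_kolyvaginPrime [W.IsElliptic] [W.IsGloballyMinimal] {ℓ : ℕ}
    (hℓ : Zhang2014.IsKolyvaginPrime (W.conductorNorm ℤ) W K 2 ℓ) :
    ∃ v : HeightOneSpectrum (𝓞 K), (ℓ : 𝓞 K) ∈ v.asIdeal := by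
  have hne : Ideal.span {(ℓ : 𝓞 K)} ≠ ⊥ := by
    rw [Ne, Ideal.span_singleton_eq_bot]
    exact_mod_cast hℓ.1.ne_zero
  exact ⟨⟨Ideal.span {(ℓ : 𝓞 K)}, hℓ.2.2.2.2.1, hne⟩, Ideal.mem_span_singleton_self _⟩

/-! ### §2 Structure-level vertices = `modifiedSelmerGroup` -/

/-- **`H¹_{selmerF W n 𝒯 (placesDividing K c)} = H_{𝓕(c)}`** for every square-free `c'`, every `c ∣ c'` and every
transverse family `𝒯` with the `c'`-description (at the places dividing `c` the family is the ring-class transverse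
condition of the prime below, which is what `modifiedSelmerGroup` imposes through `transverseKer`; JET's GLOBAL
transverse family mediates). [cite: Jetchev2008, §3.1.2 (p. 814), §3.4.1 (p. 816)] -/
theorem selmerGroup_selmerF_eq_modifiedSelmerGroup_of_dvd (ι : K →+* ℂ) [∀ j : ℕ, NumberField (ringClassField K ι j)]
    (n : ℤ) {c c' : ℕ} (hc' : Squarefree c') (hcc' : c ∣ c')
    (𝒯 : SelmerStructure ((W.baseChange K).torsionGaloisModule n))
    (h𝒯 : ∀ v : HeightOneSpectrum (𝓞 K), 𝒯 (Sum.inr v) =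
      ⨅ ℓ ∈ c'.primeFactors.filter (fun ℓ : ℕ ↦ ((ℓ : ℕ) : 𝓞 K) ∈ v.asIdeal),
        ⨅ (w' : HeightOneSpectrum (𝓞 (ringClassField K ι ℓ))) (_ : w'.asIdeal.LiesOver v.asIdeal),
          letI := (adicCompletionOfLiesOver K (ringClassField K ι ℓ) v w').toAlgebra
          transverseSubgroup (GaloisRep.toLocal v ((W.baseChange K).torsionGaloisModule n))
            (w'.adicCompletion (ringClassField K ι ℓ))) :
    (selmerF W n 𝒯 (placesDividing K c)).selmerGroup = modifiedSelmerGroup W K ι n c := by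
  have hc : Squarefree c := hc'.squarefree_of_dvd hcc'
  obtain ⟨𝒯g, h𝒯g, -⟩ := JET.Walk.exists_globalTransverseFamily W ι n
  have heq : selmerF W n 𝒯 (placesDividing K c) = selmerF W n 𝒯g (placesDividing K c) :=
    RegularRefill.selmerF_eq_of_forall_eq W n 𝒯 𝒯g (placesDividing K c) fun v hv ↦
      (JET.Walk.globalTransverse_eq_of_mem_placesDividing h𝒯g hc' h𝒯 v
        (placesDividing_subset_of_dvd hc'.ne_zero hcc' hv)).symm
  rw [heq]
  exact selmerGroup_selmerF_eq_modifiedSelmerGroup W ι n 𝒯g hc.ne_zero (JET.Walk.globalTransverse_mem_iff h𝒯g hc)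

/-- **The previous vertex of a step.** For `c' = c ℓ` square-free (`ℓ` an inert prime, `v ∣ ℓ`) and a family `𝒯` with
the `cℓ`-description: `H¹_{𝓕(cℓ)[v ↦ Kum_v]} = H_{𝓕(c)}`. [cite: Jetchev2008, §3.4.1] [cite: MazurRubin2004, §4.1] -/
theorem selmerGroup_update_kummer_eq_modifiedSelmerGroup (ι : K →+* ℂ) [∀ j : ℕ, NumberField (ringClassField K ι j)]
    (n : ℤ) {c ℓ : ℕ} (hcℓ : Squarefree (c * ℓ)) (hℓ : ℓ.Prime) (hprime : (Ideal.span {(ℓ : 𝓞 K)}).IsPrime)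
    {v : HeightOneSpectrum (𝓞 K)} (hv : (ℓ : 𝓞 K) ∈ v.asIdeal)
    (𝒯 : SelmerStructure ((W.baseChange K).torsionGaloisModule n))
    (h𝒯 : ∀ v : HeightOneSpectrum (𝓞 K), 𝒯 (Sum.inr v) =
      ⨅ ℓ' ∈ (c * ℓ).primeFactors.filter (fun ℓ' : ℕ ↦ ((ℓ' : ℕ) : 𝓞 K) ∈ v.asIdeal),
        ⨅ (w' : HeightOneSpectrum (𝓞 (ringClassField K ι ℓ'))) (_ : w'.asIdeal.LiesOver v.asIdeal),
          letI := (adicCompletionOfLiesOver K (ringClassField K ι ℓ') v w').toAlgebra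
          transverseSubgroup (GaloisRep.toLocal v ((W.baseChange K).torsionGaloisModule n))
            (w'.adicCompletion (ringClassField K ι ℓ'))) :
    SelmerStructure.selmerGroup (Function.update (selmerF W n 𝒯 (placesDividing K (c * ℓ)))
        (Sum.inr v : Place K) ((W.baseChange K).kummerSelmerStructure n (Sum.inr v : Place K)) :
        SelmerStructure ((W.baseChange K).torsionGaloisModule n)) = modifiedSelmerGroup W K ι n c := by
  have hc0 : c ≠ 0 := by rintro rfl; exact hcℓ.ne_zero (zero_mul ℓ)
  have hℓc : ¬ ℓ ∣ c := fun h ↦ by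
    have := Nat.squarefree_mul_iff.mp hcℓ
    exact hℓ.one_lt.ne' (Nat.Coprime.eq_one_of_dvd (this.1.symm) h)
  rw [RegularRefill.update_selmerF_placesDividing_mul_eq W n 𝒯 hc0 hℓ hℓc hprime hv]
  exact selmerGroup_selmerF_eq_modifiedSelmerGroup_of_dvd W ι n hcℓ (dvd_mul_right c ℓ) 𝒯 h𝒯

/-- **`H_{𝓕(c)}` is `τ_*`-stable** for every automorphism of `K` (imaginary quadratic) and every square-free `c`.
[cite: Jetchev2008, §4.3] [cite: GrossLMS1991, §5 (5.1)] -/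
theorem conjAct_mem_modifiedSelmerGroup (hK : IsImaginaryQuadratic K) (ι : K →+* ℂ)
    [∀ j : ℕ, NumberField (ringClassField K ι j)] (k : ℕ) {c : ℕ} (hc : Squarefree c)
    {x : galoisCohomology ((W.baseChange K).torsionGaloisModule ((2 ^ k : ℕ) : ℤ)) 1}
    (hx : x ∈ modifiedSelmerGroup W K ι ((2 ^ k : ℕ) : ℤ) c) (τ : K ≃ₐ[ℚ] K) :
    conjAct W τ ((2 ^ k : ℕ) : ℤ) x ∈ modifiedSelmerGroup W K ι ((2 ^ k : ℕ) : ℤ) c := by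
  set 𝒯 : SelmerStructure ((W.baseChange K).torsionGaloisModule ((2 ^ k : ℕ) : ℤ)) := fun v ↦ match v with
    | Sum.inl _ => ⊤
    | Sum.inr v => ⨅ ℓ ∈ c.primeFactors.filter (fun ℓ : ℕ ↦ ((ℓ : ℕ) : 𝓞 K) ∈ v.asIdeal),
        ⨅ (w' : HeightOneSpectrum (𝓞 (ringClassField K ι ℓ))) (_ : w'.asIdeal.LiesOver v.asIdeal),
          letI := (adicCompletionOfLiesOver K (ringClassField K ι ℓ) v w').toAlgebra
          transverseSubgroup (GaloisRep.toLocal v ((W.baseChange K).torsionGaloisModule ((2 ^ k : ℕ) : ℤ)))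
            (w'.adicCompletion (ringClassField K ι ℓ)) with h𝒯def
  have h𝒯 : ∀ v : HeightOneSpectrum (𝓞 K), 𝒯 (Sum.inr v) =
      ⨅ ℓ ∈ c.primeFactors.filter (fun ℓ : ℕ ↦ ((ℓ : ℕ) : 𝓞 K) ∈ v.asIdeal),
        ⨅ (w' : HeightOneSpectrum (𝓞 (ringClassField K ι ℓ))) (_ : w'.asIdeal.LiesOver v.asIdeal),
          letI := (adicCompletionOfLiesOver K (ringClassField K ι ℓ) v w').toAlgebra
          transverseSubgroup (GaloisRep.toLocal v ((W.baseChange K).torsionGaloisModule ((2 ^ k : ℕ) : ℤ)))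
            (w'.adicCompletion (ringClassField K ι ℓ)) := fun v ↦ rfl
  have heq := selmerGroup_selmerF_eq_modifiedSelmerGroup_of_dvd W ι ((2 ^ k : ℕ) : ℤ) hc dvd_rfl 𝒯 h𝒯
  rw [← heq] at hx ⊢
  exact RegularRefill.conjAct_mem_selmerGroup_selmerF W k hK ι c hc 𝒯 h𝒯 hx τ

/-- **Every vertex `H_{𝓕(c)}(K, E[n])` is finite** (`n ≠ 0`, `c` square-free): it is the Selmer group of a
relaxed–transverse Kummer structure, finite by Silverman X.4.3/X.4.4. [cite: SilvermanAEC2009, Lemma X.4.3, Cor. X.4.4] -/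
theorem finite_modifiedSelmerGroup (ι : K →+* ℂ) [∀ j : ℕ, NumberField (ringClassField K ι j)]
    [(W.baseChange K).IsElliptic] {n : ℤ} (hn : n ≠ 0) {c : ℕ} (hc : Squarefree c) :
    Finite (modifiedSelmerGroup W K ι n c) := by
  obtain ⟨𝒯g, h𝒯g, -⟩ := JET.Walk.exists_globalTransverseFamily W ι n
  have heq := selmerGroup_selmerF_eq_modifiedSelmerGroup W ι n 𝒯g hc.ne_zero
    (JET.Walk.globalTransverse_mem_iff h𝒯g hc)
  -- a finite place of `K`
  obtain ⟨M, hM⟩ := Ideal.exists_maximal (𝓞 K)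
  let v : HeightOneSpectrum (𝓞 K) :=
    ⟨M, hM.isPrime, Ring.ne_bot_of_isMaximal_of_not_isField hM (RingOfIntegers.not_isField K)⟩
  haveI hfin := JET.Walk.finite_selmerGroup_transverseAt_relaxedAt (W.baseChange K) hn 𝒯g (placesDividing K c) v
  have hle : (selmerF W n 𝒯g (placesDividing K c)).selmerGroup ≤
      ((((W.baseChange K).kummerSelmerStructure n).transverseAt 𝒯g (placesDividing K c)).relaxedAt {v}).selmerGroup := by
    refine JET.GlobalDuality.selmerGroup_mono fun w ↦ ?_
    cases w with
    | inl w => exact le_of_eq (SelmerStructure.modify_inl _ _ _ _ _ w).symm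
    | inr q =>
      by_cases hq : q ∈ ({v} : Finset (HeightOneSpectrum (𝓞 K)))
      · simp [SelmerStructure.relaxedAt, hq]
      · simp [SelmerStructure.relaxedAt, SelmerStructure.modify_inr, hq, selmerF]
  rw [← heq]
  exact Finite.of_injective _ (AddSubgroup.inclusion_injective hle)

/-! ### §3 The inflation kernel on the habitat -/

/-- **Sah at `2` on the habitat.** `K` imaginary quadratic, `ρ_{E,2^(k+1)}` onto: a class of `H¹(K, E[2^k])`
vanishing on `Γ_{K(E[2^(k+1)])}` is killed by `2`. [cite: GrossLMS1991, §9 Prop. 9.1] [cite: Sah1968, Prop. 2.7 (b)] -/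
theorem two_zsmul_eq_zero_of_res_eq_zero [W.IsElliptic] (hK : IsImaginaryQuadratic K) {k : ℕ}
    (hsurj : W.HasSurjectiveModNGaloisRep ((2 ^ (k + 1) : ℕ) : ℤ))
    {x : galH1Torsion (W.baseChange K) ((2 ^ k : ℕ) : ℤ)}
    (hx : ∀ ρ ∈ torsionFixing (W.baseChange K) ((2 ^ (k + 1) : ℕ) : ℤ),
      h1Eval (W.baseChange K) ((2 ^ k : ℕ) : ℤ) x ρ = 0) :
    (2 : ℤ) • x = 0 := by
  have h := KolyvaginLowerBoundAtTwo.inflationDefect_one_of_hasSurjectiveModNGaloisRep W hK.1 (M := k) (M' := k + 1)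
    (by omega) (by omega) hsurj x hx
  rwa [pow_one] at h

/-- **Φ-KILL** (re-export of `RegularRefill.localization_eq_zero_of_forall_h1Eval_eq_zero`, p689128): a class vanishing on
`Γ_{K(E[2^(k+1)])}` is locally trivial at every Kolyvagin place of index `≥ k + 1`. [cite: GrossLMS1991, §9]
[cite: McCallumLMS1991, §3] -/
theorem localization_eq_zero_of_res_eq_zero [W.IsElliptic] [W.IsGloballyMinimal] (hK : IsImaginaryQuadratic K)
    {k ℓ : ℕ} (hℓ : Zhang2014.IsKolyvaginPrime (W.conductorNorm ℤ) W K 2 ℓ)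
    (hk1 : k + 1 ≤ Zhang2014.kolyvaginIndex W 2 ℓ) (v : HeightOneSpectrum (𝓞 K)) (hv : (ℓ : 𝓞 K) ∈ v.asIdeal)
    {x : galoisCohomology ((W.baseChange K).torsionGaloisModule ((2 ^ k : ℕ) : ℤ)) 1}
    (hx : ∀ ρ ∈ torsionFixing (W.baseChange K) ((2 ^ (k + 1) : ℕ) : ℤ),
      h1Eval (W.baseChange K) ((2 ^ k : ℕ) : ℤ) x ρ = 0) :
    galoisCohomology.localization ((W.baseChange K).torsionGaloisModule ((2 ^ k : ℕ) : ℤ)) (Sum.inr v : Place K) 1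
      x = 0 :=
  RegularRefill.localization_eq_zero_of_forall_h1Eval_eq_zero W hK hℓ hk1 v hv hx

end Summit.BirchSwinnertonDyer.BirchSwinnertonDyer.Theorems.KolyvaginAtTwo.RegularWalk

end
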